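import Mathlib
import HarnessLib
import Summits.KontsevichZagierPeriods.KontsevichZagierPeriods.Theorems.LinRedNormalFormResidualBeyondGenusZeroSplice
import Summits.KontsevichZagierPeriods.KontsevichZagierPeriods.Theorems.RealOnePeriodRelations.Negative.Kit
import Summits.KontsevichZagierPeriods.KontsevichZagierPeriods.Theorems.SymplecticScissorsRealOnePeriodRelationsConditional

/-!
# Route LinRedNormalForm, item `ResidualBeyondGenusZero` (stmt-KontsevichZagierPeriods-3917): the tenure split along the one-dimensional sector

`ResidualBeyondGenusZero` (RES) is the DECLARED RESIDUAL of route LinRedNormalForm: every vanishing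
formal combination of integral representations is congruent modulo `KZ.relations` to a
`ℤ`-combination of genus-zero representations. It is summit-strength
(`LinRedNormalFormResidualBeyondGenusZeroStrength.lean`) and held, to be revisited only by a TENURE
SPLIT `RES ⇐ (next-sector normal form) → (next-sector kernel) → (smaller residual)`, whose generic
glue is `residualBeyondGenusZero_of_splice` (`LinRedNormalFormResidualBeyondGenusZeroSplice.lean`).

This file instantiates that glue on the first sector beyond genus zero for which the tree already
holds the move-level content: the ONE-DIMENSIONAL representations `H₁ = closure (range KZ.of₁)`
(real curve-type periods). Route SymplecticScissors has landed, conditionally on the Huber–Wüstholz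
theorem for periods of curve type (`Literature.NumberTheory.Transcendental.HuberWustholzCurvePeriods`,
a named fact), that every vanishing element of `H₁` lies in
`M₁ = closure (1a ∪ 1b ∪ 2 ∪ greenSet)`
(`SymplecticScissors.RealOnePeriodRelations.realOnePeriodRelations_of_huberWustholzCurvePeriods`);
the only move-level gap between `M₁` and `KZ.relations` is the typed Green generator
`greenSet ⊆ KZ.relations` (the registered stub `stub_greenInRelations` of crux `PlanarAreas`,
line `green-native-bands`), taken here as a hypothesis.

* `dimOne_kernel_le_relations` — `RealOnePeriodRelations → greenSet ⊆ relations →` every vanishing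
  element of `H₁` is a relation (the kernel form of Conjecture 1 on the one-dimensional sector).
* `residualBeyondGenusZero_iff_dimOne_split` — granted those two, RES is EQUIVALENT to the
  conjunction of (RES₁) the smaller declared residual over `gzSet ∪ range of₁` and (Mix) the
  relative kernel of the joint sector with its pure-`H₁` part discharged: a vanishing element of
  `closure (gzSet ∪ range of₁)` is, modulo relations, a genus-zero combination plus a VANISHING
  one-dimensional combination. Both conjuncts are implied by RES (so by the summit): the split loses
  nothing and isolates exactly what the one-dimensional sector still owes.
* `mix_of_ratValues` — the clean value-level sufficient condition for (Mix): if a `ℤ`-combination of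
  genus-zero values that is minus the value of a one-dimensional combination is RATIONAL, then (Mix)
  holds with no move at all, because the shared constants `[Δ₁, q]` are at once genus-zero and
  one-dimensional (`isGenusZero_constMul_oneRep`). This value statement is the sector's transcendence
  input (period-conjecture strength: multiple zeta values have weight ≥ 2, one-dimensional periods
  weight ≤ 1); it is NOT implied by the summit as formalised and is offered only as the natural
  declared antecedent, next to the summit-implied (Mix).
* `residualBeyondGenusZero_of_huberWustholz_dimOne` — the composed split over the named fact:
  `HuberWustholzCurvePeriods → greenSet ⊆ relations → RES₁ → (rational values) → RES`.

Nothing here attacks RES itself (it stays blocked on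
`Literature.NumberTheory.Transcendental.KZKernelConjecture`); the file makes the planner's tenure
split along the one-dimensional sector a one-line filing whose glue is already proved.

References: M. Kontsevich, D. Zagier, *Periods* (2001), §1.2, Conjecture 1; A. Huber, G. Wüstholz,
*Transcendence and Linear Relations of 1-Periods* (2022), Thm 13.3 (2); A. Huber, S. Müller-Stach,
*Periods and Nori Motives* (2017), Conj. 13.2.1.
-/

noncomputable section

namespace Summit.KontsevichZagierPeriods.ResidualBeyondGenusZero

open Literature.NumberTheory.Transcendental
open Summit.KontsevichZagierPeriods.KontsevichZagierPeriods.Theses.LinRedNormalForm (ResidualBeyondGenusZero)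
open Summit.KontsevichZagierPeriods.KontsevichZagierPeriods.Theses.SymplecticScissors (RealOnePeriodRelations)
open Summit.KontsevichZagierPeriods.SymplecticScissors.RealOnePeriodRelationsNegative (greenSet M₁ H₁)
open Summit.KontsevichZagierPeriods.DihedralNormalForm.Negative
  (IsGenusZero gzIntegrand oneRep oneRep_domain oneRep_integrand oneRep_value isGenusZero_oneRep)

/-! ## §1 The one-dimensional kernel from `RealOnePeriodRelations` and the Green generator -/

/-- If every instance of the typed Green generator lies in `KZ.relations`, then the whole target
subgroup `M₁ = closure (1a ∪ 1b ∪ 2 ∪ greenSet)` of `RealOnePeriodRelations` does (the three move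
sets generate `KZ.relations` together with Newton–Leibniz). [folklore] -/
theorem m₁_le_relations_of_greenSet_subset
    (hG : greenSet ⊆ (KZ.relations : Set KZ.FormalRep)) : M₁ ≤ KZ.relations := by
  refine (AddSubgroup.closure_le _).mpr ?_
  rintro c (((hc | hc) | hc) | hc)
  · exact KZ.domainAddRel_subset_relations hc
  · exact KZ.integrandAddRel_subset_relations hc
  · exact KZ.changeOfVariablesRel_subset_relations hc
  · exact hG hc

/-- **The kernel of Conjecture 1 on the one-dimensional sector.** Granted `RealOnePeriodRelations`
(crux stmt-KontsevichZagierPeriods-10042 of route SymplecticScissors: vanishing elements of `H₁` lie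
in `M₁`; landed conditionally on the Huber–Wüstholz theorem) and `greenSet ⊆ KZ.relations`, every
vanishing `ℤ`-combination of one-dimensional representations is a relation of the KZ calculus.
[folklore] -/
theorem dimOne_kernel_le_relations (hR : RealOnePeriodRelations)
    (hG : greenSet ⊆ (KZ.relations : Set KZ.FormalRep)) :
    ∀ h ∈ H₁, KZ.eval h = 0 → h ∈ KZ.relations := fun h hh hh0 =>
  m₁_le_relations_of_greenSet_subset hG
    ((Summit.KontsevichZagierPeriods.SymplecticScissors.RealOnePeriodRelationsNegative.crux_iff.mp hR)
      h hh hh0)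

/-! ## §2 The split: RES ↔ (smaller residual) ∧ (relative kernel with the `H₁`-part discharged) -/

/-- **RES from the one-dimensional split.** Hypotheses: `RealOnePeriodRelations` and
`greenSet ⊆ KZ.relations` (the one-dimensional sector's move content, owned by route
SymplecticScissors); (RES₁) the SMALLER declared residual — every vanishing combination is congruent
modulo relations to a `ℤ`-combination of genus-zero and one-dimensional representations; (Mix) every
vanishing element of `closure (gzSet ∪ range of₁)` is congruent modulo relations to `g + h` with `g`
a genus-zero combination and `h ∈ H₁` VANISHING. Then `ResidualBeyondGenusZero`: by
`dimOne_kernel_le_relations` the vanishing `h` is itself a relation, so (Mix) is the relative kernel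
(iii) of `residualBeyondGenusZero_of_splice` with `T = N = range of₁`, whose normal form (ii) is the
identity. [folklore] -/
theorem residualBeyondGenusZero_of_dimOne_split (hR : RealOnePeriodRelations)
    (hG : greenSet ⊆ (KZ.relations : Set KZ.FormalRep))
    (hRes₁ : ∀ c : KZ.FormalRep, KZ.eval c = 0 →
      ∃ c₁ ∈ AddSubgroup.closure (Negative.gzSet ∪ Set.range fun r : KZ.IntegralRep 1 => KZ.of r),
        c - c₁ ∈ KZ.relations)
    (hMix : ∀ m ∈ AddSubgroup.closure (Negative.gzSet ∪ Set.range fun r : KZ.IntegralRep 1 => KZ.of r),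
      KZ.eval m = 0 → ∃ g ∈ AddSubgroup.closure Negative.gzSet, ∃ h ∈ H₁,
        KZ.eval h = 0 ∧ m - g - h ∈ KZ.relations) :
    ResidualBeyondGenusZero :=
  residualBeyondGenusZero_of_splice (Set.range fun r : KZ.IntegralRep 1 => KZ.of r)
    (Set.range fun r : KZ.IntegralRep 1 => KZ.of r) hRes₁
    (fun x hx => ⟨x, AddSubgroup.subset_closure (Or.inr hx), by simp⟩)
    (fun m hm hm0 => by
      obtain ⟨g, hg, h, hh, hh0, hmgh⟩ := hMix m hm hm0
      refine ⟨g, hg, ?_⟩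
      have key := add_mem hmgh (dimOne_kernel_le_relations hR hG h hh hh0)
      rwa [sub_add_cancel] at key)

/-- **The split loses nothing.** Conversely `ResidualBeyondGenusZero` implies (RES₁) (monotonicity
of `closure`) and (Mix) (take `h = 0` and `g` the genus-zero normal form RES provides); so both
antecedents are implied by the summit (`residualBeyondGenusZero_of_kontsevichZagierPeriods`), as a
declared residual and a declared relative kernel must be. [folklore] -/
theorem dimOne_split_of_residualBeyondGenusZero (hRES : ResidualBeyondGenusZero) :
    (∀ c : KZ.FormalRep, KZ.eval c = 0 →
      ∃ c₁ ∈ AddSubgroup.closure (Negative.gzSet ∪ Set.range fun r : KZ.IntegralRep 1 => KZ.of r),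
        c - c₁ ∈ KZ.relations) ∧
    (∀ m ∈ AddSubgroup.closure (Negative.gzSet ∪ Set.range fun r : KZ.IntegralRep 1 => KZ.of r),
      KZ.eval m = 0 → ∃ g ∈ AddSubgroup.closure Negative.gzSet, ∃ h ∈ H₁,
        KZ.eval h = 0 ∧ m - g - h ∈ KZ.relations) := by
  rw [Negative.residual_iff] at hRES
  refine ⟨fun c hc => ?_, fun m _ hm0 => ?_⟩
  · obtain ⟨c₀, hc₀, hcc₀⟩ := hRES c hc
    exact ⟨c₀, AddSubgroup.closure_mono Set.subset_union_left hc₀, hcc₀⟩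
  · obtain ⟨c₀, hc₀, hmc₀⟩ := hRES m hm0
    exact ⟨c₀, hc₀, 0, zero_mem _, by simp, by simpa using hmc₀⟩

/-- **The tenure split along the one-dimensional sector, as an equivalence.** Granted
`RealOnePeriodRelations` and `greenSet ⊆ KZ.relations`, the declared residual
`ResidualBeyondGenusZero` is equivalent to (RES₁) ∧ (Mix) of
`residualBeyondGenusZero_of_dimOne_split`. What the split buys: the one-dimensional sector's move
content is discharged by route SymplecticScissors; what stays declared is the residual beyond
`genus zero ∪ dimension one` and the separation of the `H₁`-part of a mixed vanishing combination
(see `mix_of_ratValues` for its value-level form). [folklore] -/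
theorem residualBeyondGenusZero_iff_dimOne_split (hR : RealOnePeriodRelations)
    (hG : greenSet ⊆ (KZ.relations : Set KZ.FormalRep)) :
    ResidualBeyondGenusZero ↔
      (∀ c : KZ.FormalRep, KZ.eval c = 0 →
        ∃ c₁ ∈ AddSubgroup.closure (Negative.gzSet ∪ Set.range fun r : KZ.IntegralRep 1 => KZ.of r),
          c - c₁ ∈ KZ.relations) ∧
      (∀ m ∈ AddSubgroup.closure (Negative.gzSet ∪ Set.range fun r : KZ.IntegralRep 1 => KZ.of r),
        KZ.eval m = 0 → ∃ g ∈ AddSubgroup.closure Negative.gzSet, ∃ h ∈ H₁,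
          KZ.eval h = 0 ∧ m - g - h ∈ KZ.relations) :=
  ⟨dimOne_split_of_residualBeyondGenusZero,
    fun h => residualBeyondGenusZero_of_dimOne_split hR hG h.1 h.2⟩

/-! ## §3 The value-level form of (Mix): shared constants are genus-zero AND one-dimensional -/

/-- The constant representation `[Δ₁, q]` (the open interval with the rational constant integrand
`q`, i.e. `oneRep` scaled by `q`) has the genus-zero shape of the crux: numerator `C q`, all
exponents `0`. [folklore] -/
theorem isGenusZero_constMul_oneRep (q : ℚ) :
    IsGenusZero (oneRep.constMul (q : ℝ) (isAlgebraic_algebraMap q)) := by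
  refine ⟨MvPolynomial.C q, fun _ _ => 0, fun _ => 0, fun _ => 0, rfl, ?_⟩
  intro t _
  rw [KZ.IntegralRep.integrand_constMul]
  simp only [oneRep_integrand, mul_one]
  simp [gzIntegrand]

/-- `[Δ₁, q]` is a genus-zero generator: `KZ.of [Δ₁, q] ∈ gzSet`. [folklore] -/
theorem of_constMul_oneRep_mem_gzSet (q : ℚ) :
    KZ.of (oneRep.constMul (q : ℝ) (isAlgebraic_algebraMap q)) ∈ Negative.gzSet :=
  ⟨1, _, isGenusZero_constMul_oneRep q, rfl⟩

/-- `[Δ₁, q]` is one-dimensional: `KZ.of [Δ₁, q] ∈ H₁`. [folklore] -/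
theorem of_constMul_oneRep_mem_H₁ (q : ℚ) :
    KZ.of (oneRep.constMul (q : ℝ) (isAlgebraic_algebraMap q)) ∈ H₁ :=
  AddSubgroup.subset_closure ⟨_, rfl⟩

/-- `eval [Δ₁, q] = q`. [folklore] -/
theorem eval_of_constMul_oneRep (q : ℚ) :
    KZ.eval (KZ.of (oneRep.constMul (q : ℝ) (isAlgebraic_algebraMap q))) = q := by
  rw [KZ.eval_of, KZ.IntegralRep.value_constMul, oneRep_value, mul_one]

/-- **(Mix) from rational shared values.** Suppose that whenever a `ℤ`-combination `g` of
genus-zero representations and a `ℤ`-combination `h` of one-dimensional representations have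
opposite values, that common value is RATIONAL (the sector's transcendence input: a `ℚ`-combination
of multiple zeta values which is a real one-dimensional period is rational — period-conjecture
strength, by weights). Then (Mix) holds with no move at all: write a vanishing
`m ∈ closure (gzSet ∪ range of₁)` as `g + h` (`closure` of a union is the `⊔`), let `eval g = q`,
and move the shared constant across with `[Δ₁, q]`, which is both genus-zero and one-dimensional:
`m = (g − [Δ₁,q]) + (h + [Δ₁,q])` on the nose, with `eval (h + [Δ₁,q]) = −q + q = 0`. [folklore] -/
theorem mix_of_ratValues
    (hV : ∀ g ∈ AddSubgroup.closure Negative.gzSet, ∀ h ∈ H₁,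
      KZ.eval g + KZ.eval h = 0 → ∃ q : ℚ, KZ.eval g = q) :
    ∀ m ∈ AddSubgroup.closure (Negative.gzSet ∪ Set.range fun r : KZ.IntegralRep 1 => KZ.of r),
      KZ.eval m = 0 → ∃ g ∈ AddSubgroup.closure Negative.gzSet, ∃ h ∈ H₁,
        KZ.eval h = 0 ∧ m - g - h ∈ KZ.relations := by
  intro m hm hm0
  rw [AddSubgroup.closure_union] at hm
  obtain ⟨g, hg, h, hh, rfl⟩ := AddSubgroup.mem_sup.mp hm
  rw [map_add] at hm0
  obtain ⟨q, hq⟩ := hV g hg h hh hm0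
  refine ⟨g - KZ.of (oneRep.constMul (q : ℝ) (isAlgebraic_algebraMap q)),
    sub_mem hg (AddSubgroup.subset_closure (of_constMul_oneRep_mem_gzSet q)),
    h + KZ.of (oneRep.constMul (q : ℝ) (isAlgebraic_algebraMap q)),
    add_mem hh (of_constMul_oneRep_mem_H₁ q), ?_, ?_⟩
  · rw [map_add, eval_of_constMul_oneRep]
    linarith
  · rw [show g + h - (g - KZ.of (oneRep.constMul (q : ℝ) (isAlgebraic_algebraMap q))) -
        (h + KZ.of (oneRep.constMul (q : ℝ) (isAlgebraic_algebraMap q))) = 0 by abel]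
    exact zero_mem _

/-- **RES from the value-level split**: `RealOnePeriodRelations`, the Green generator in
`KZ.relations`, the smaller declared residual (RES₁) and the rational-shared-values statement of
`mix_of_ratValues` together give `ResidualBeyondGenusZero`. [folklore] -/
theorem residualBeyondGenusZero_of_dimOne_ratValues (hR : RealOnePeriodRelations)
    (hG : greenSet ⊆ (KZ.relations : Set KZ.FormalRep))
    (hRes₁ : ∀ c : KZ.FormalRep, KZ.eval c = 0 →
      ∃ c₁ ∈ AddSubgroup.closure (Negative.gzSet ∪ Set.range fun r : KZ.IntegralRep 1 => KZ.of r),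
        c - c₁ ∈ KZ.relations)
    (hV : ∀ g ∈ AddSubgroup.closure Negative.gzSet, ∀ h ∈ H₁,
      KZ.eval g + KZ.eval h = 0 → ∃ q : ℚ, KZ.eval g = q) :
    ResidualBeyondGenusZero :=
  residualBeyondGenusZero_of_dimOne_split hR hG hRes₁ (mix_of_ratValues hV)

/-! ## §4 Over the named fact: the Huber–Wüstholz theorem for periods of curve type -/

/-- **The tenure split along the one-dimensional sector, composed over the literature.** If every
`ℚ̄`-linear relation among periods of curve type is a `ℚ̄`-combination of elementary relations
(`HuberWustholzCurvePeriods`, Huber–Wüstholz 2022, Thm 13.3 (2) — a named fact, taken as a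
hypothesis; it gives `RealOnePeriodRelations` by
`SymplecticScissors.RealOnePeriodRelations.realOnePeriodRelations_of_huberWustholzCurvePeriods`),
the typed Green generator lies in `KZ.relations`, the smaller residual (RES₁) holds and shared
values are rational, then `ResidualBeyondGenusZero`. Conditional on exactly: one published theorem,
one move-level stub of a sibling crux, and two declared statements each weaker than what they
replace. [cite: HuberWustholz2022, Thm 13.3 (2)] -/
theorem residualBeyondGenusZero_of_huberWustholz_dimOne (hHW : HuberWustholzCurvePeriods)
    (hG : greenSet ⊆ (KZ.relations : Set KZ.FormalRep))
    (hRes₁ : ∀ c : KZ.FormalRep, KZ.eval c = 0 →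
      ∃ c₁ ∈ AddSubgroup.closure (Negative.gzSet ∪ Set.range fun r : KZ.IntegralRep 1 => KZ.of r),
        c - c₁ ∈ KZ.relations)
    (hV : ∀ g ∈ AddSubgroup.closure Negative.gzSet, ∀ h ∈ H₁,
      KZ.eval g + KZ.eval h = 0 → ∃ q : ℚ, KZ.eval g = q) :
    ResidualBeyondGenusZero :=
  residualBeyondGenusZero_of_dimOne_ratValues
    (Summit.KontsevichZagierPeriods.SymplecticScissors.RealOnePeriodRelations.realOnePeriodRelations_of_huberWustholzCurvePeriods
      hHW)
    hG hRes₁ hV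

end Summit.KontsevichZagierPeriods.ResidualBeyondGenusZero

end
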